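import Mathlib

/-!
# T6N5LocalDatum — Tier 6, M2 sub-step N5 (t6-p8's half, TARGET-T6 §4 L4 / T6-N5-t6-p7.md §4 row T6N5Local):
the LOCAL sign datum at one finite place `v` of `F` non-split in `E`

The objects of TIER5 §N5.11 (route/T5-route-2.md N5.11.2, «Notation») and of Borade–Franzel–Girsch–Yao–Yu–Zelingher,
Selecta Math. 31 (2025) art. 49, §3.3 (the (U(1), U(1)) ε-dichotomy), carried as DATA ONLY: the characters of
`E_v^×` as an abstract commutative group with the restriction map to the characters of `F_v^×` (so that
«conjugate-symplectic» / «conjugate-orthogonal» are DEFINED by the restriction, GGP Lemma 3.4), the root numbers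
`ε_v(ξ) = ε_{E_v/F_v}(ξ, ψ_v, δ)` of Borade's tuple ([Bo-eps-tuple] §3.3.1), the splitting character `χ_W` of the
datum's skew-hermitian line, `ϵ_δ(W)`, the theta non-vanishing predicate `Θ_{V_s,W,ι̃,ψ}(α ∘ i′_V) ≠ 0` for the two
isometry classes `s = ϵ(V_s)` of hermitian lines, and the quadratic symbols `ω_{E_v/F_v}(λ_i)`, `η_v(u)` of the line
data. Every printed property is a displayed hypothesis (`T6N5LocalHyp.lean`) or an explicit binder of
`T6N5Local.N5Local_main`.
README §8(d): uses an L-value-free non-vanishing device: NO.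
-/

namespace Summit.Ventures.HodgeRepro2.T6.N5LocalDatum

/-- The local sign datum at a finite place `v` of `F` non-split in `E` (TIER5 §N5.11.2; data only). -/
structure LocalSignDatum where
  /-- The characters `ξ : E_v^× → ℂ^×` (Borade's characters `χ : K^× → ℂ^×`, §3.3.1), as an abstract commutative
  group under pointwise multiplication. -/
  Char : Type
  [instChar : CommGroup Char]
  /-- The characters of `F_v^×`, as an abstract commutative group. -/
  FChar : Type
  [instFChar : CommGroup FChar]
  /-- Restriction of characters of `E_v^×` to `F_v^×` (a group homomorphism). -/
  res : Char →* FChar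
  /-- `η_v = ω_{E_v/F_v}`, the quadratic character of `F_v^×` attached to `E_v/F_v` (TIER5 §N5.11.2 «η_v = ω_{E_v/F_v}»). -/
  η : FChar
  /-- `ε_v(ξ) := ε_{E_v/F_v}(ξ, ψ_v, δ) ∈ {±1}`: Borade's root number of a conjugate-dual character
  ([Bo-eps-tuple] §3.3.1: «ε_{L_E/E}(χ, ψ, δ) = ε^{Tate}_{L_E}(½, χ, ψ_δ ∘ tr_{L_E/K})», a sign), for the datum's
  `ψ_v` and trace-zero `δ`. -/
  eps : Char → ℤˣ
  /-- `χ_W`, the splitting character of the datum's skew-hermitian line `W` (= `ξ′_{A,v}`, TIER5 N5.3 row ξ′_A). -/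
  χW : Char
  /-- `ϵ_δ(W) = ω_{E_v/F_v}(δ · disc W)` (Borade §2.2.2 [Bo-eps-V]; = +1 by the datum's H10). -/
  epsdW : ℤˣ
  /-- `Θ_{V_s,W,ι̃,ψ}(α ∘ i′_V) ≠ 0`: the non-vanishing of the theta lift of the character `α` of `K¹ = E¹_v`
  (carried through `α_K = α ∘ j`, a conjugate-orthogonal character of `E_v^×`) for the hermitian line `V_s` of
  sign `s = ϵ(V_s) = ω_{E_v/F_v}(disc V_s)` (Borade §3.3.3, the two isometry classes of hermitian lines). -/
  Theta : ℤˣ → Char → Prop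
  /-- `ω_{E_v/F_v}(λ_i)` for the two line data `λ_a = w⁻¹e_{111}`, `λ_b = w⁻¹e_{100}` (TIER5 N5.3; the signs
  `s_a`, `s_b` of §N5.11.2). -/
  ηLine : Fin 2 → ℤˣ
  /-- `η_v(u)` (TIER5 §N5.5(e): `= −1` exactly at `v ∈ S_g`). -/
  ηu : ℤˣ

attribute [instance] LocalSignDatum.instChar LocalSignDatum.instFChar

namespace LocalSignDatum

variable (D : LocalSignDatum)

/-- «conjugate-symplectic»: `ξ|_{F_v^×} = η_v` (GGP 2012 Lemma 3.4 p. 11; [FM21] «symplectic type»;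
TIER5 §N5.11.2). -/
def IsCS (ξ : D.Char) : Prop := D.res ξ = D.η

/-- «conjugate-orthogonal»: `ξ|_{F_v^×} = 1` (GGP 2012 Lemma 3.4 p. 11; TIER5 §N5.11.2) — the characters
`α_K = α ∘ j` of characters `α` of `E¹_v`. -/
def IsCO (ξ : D.Char) : Prop := D.res ξ = 1

/-- The sign class `C_s(v) := {ξ conjugate-symplectic : ε_v(ξ) = s}` (TIER5 §N5.11.2). -/
def signClass (s : ℤˣ) : Set D.Char := {ξ | D.IsCS ξ ∧ D.eps ξ = s}

end LocalSignDatum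

end Summit.Ventures.HodgeRepro2.T6.N5LocalDatum
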